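import Summits.BirchSwinnertonDyer.BirchSwinnertonDyer.Theorems.ResidualThetaTransportAtTwoRlfSubgroupKummerIsotropy
import Summits.BirchSwinnertonDyer.BirchSwinnertonDyer.Theorems.ThetaPartnerAtTwoSignedKatoUpToAtTwoLayerPairingModDefs
import Literature.NumberTheory.EllipticCurves.BurungaleKobayashiNakamuraOta2026.LocalBottomIndex
import Literature.NumberTheory.GaloisRepresentations.LocalGlobalCohomologyTateProofs
import HarnessLib

/-!
# Route `ResidualThetaTransportAtTwo` (RTT P6, item stmt-BirchSwinnertonDyer-23110, road T), H-PLUSDUAL brick (ISO-1b):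
# the Kummer image is isotropic AT A LAYER — in the LOCAL SUBGROUP-KUMMER currency of the layer Tate pairings

Seat `prover-bsd-wall-tp2-p2x` g12 LEAD (`--supports stmt-BirchSwinnertonDyer-23110`). THEOREMS ONLY (no definition, no named fact, no
instance, no `sorry`); closes nothing; BSD is NOT proved by any of this.

w2 g15's ISO-1a (`LayerKummerIso.exists_muCarrier_coboundary_subgroup`, file `…RlfSubgroupKummerIsotropy`) proves Poonen–Rains' Kummer isotropy
(Prop. 4.8 / Cor. 4.6) for a closed subgroup `U ≤ Γ_F` of the absolute Galois group of ANY field `F` and points of `E(F̄)` whose `n`-multiple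
is fixed by `U`, in cochain form. The consumer — the layer self-isotropy of Kim 2007 Prop. 3.15 at `2` through the Shapiro model
(`ShapiroCup.cupProduct_shapiroCocycle_eq_zero_of_coboundary`, file `…RlfShapiroCupCoboundary`) — needs it for the curve `E/ℚ` read at the
local field `ℚ_v`, i.e. for `U ≤ Γ_{ℚ_v}`, the LOCAL points `E(ℚ̄_v)` (`localPoints W ℚ_v`), the subgroup Kummer cocycles
`WeierstrassCurve.subgroupKummerCocycle` (values in `E[N](ℚ̄)|_{Γ_{ℚ_v}}`, file `SubgroupKummerClass`) and the local Weil pairing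
`SignedKatoOffTwo.LayerPairing.weilLocalPairing` with values in `μ_N(ℚ̄)|_{Γ_{ℚ_v}}` (file `…SignedKatoUpToAtTwoLayerPairingModDefs`). This
file is that transport: ISO-1a is applied to the local curve `W_{ℚ_v} = W.baseChange ℚ_v` (whose geometric points ARE the local points,
`localPointsToGeomPoints`), with the Weil datum carried to `E_{ℚ_v}[N](ℚ̄_v)` along the torsion comparison `torsionPointsEquiv` and the
embedding `ι : ℚ̄ → ℚ̄_v` (`closureEmb`, equivariant by `closureEmb_resGal_smul` / `torsionPointsEquiv_symm_smul`), and the resulting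
`μ_N(ℚ̄_v)`-valued cochain is pulled back to `μ_N(ℚ̄)` along `muTransferEquiv` (equivariant by `muTransfer_mu`).

* **`exists_coboundary_weilLocalPairing_subgroupKummerCocycle`** — for `U ≤ Γ_{ℚ_v}` closed and `Q₁, Q₂ ∈ E(ℚ̄_v)` with `N•Q_i` fixed by
  `U`, there is `β : C(U, μ_N(ℚ̄)|)` with `e(κ_U(Q₁)(a), a·κ_U(Q₂)(b)) = a·β(b) − β(ab) + β(a)` for all `a, b ∈ U` — EXACTLY the hypothesis
  `hβ` of `cupProduct_shapiroCocycle_eq_zero_of_coboundary` for the pair of subgroup Kummer cocycles and the local Weil pairing.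

References: [PoonenRains2012] Prop. 4.8, Cor. 4.6; [BDKim2007] Prop. 3.15; [SilvermanAEC2009] VIII §2, X §4.
-/

-- the Theorems namespace of this sub repeats the summit name by design (D-0017 nested layout)
set_option linter.dupNamespace false

noncomputable section

open scoped Classical Topology

namespace Summit.BirchSwinnertonDyer.BirchSwinnertonDyer.Theorems.SignedEC.LayerKummerIso

open Field NumberField IsDedekindDomain WeierstrassCurve Literature.NumberTheory.EllipticCurves
  Literature.NumberTheory.GaloisRepresentations
open Literature.NumberTheory.GaloisRepresentations.DiscreteGaloisModule (mu MuCarrier)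
open Summit.BirchSwinnertonDyer.BirchSwinnertonDyer.Theorems.SignedKatoOffTwo.LayerPairing

/-- **Kummer isotropy at a layer, local subgroup-Kummer currency (ISO-1b).** For `W/ℚ` elliptic, `N ≥ 1`, an ALTERNATING Weil datum
`e` on `E[N](ℚ̄)`, a finite place `v`, a closed subgroup `U ≤ Γ_{ℚ_v}` and local points `Q₁, Q₂ ∈ E(ℚ̄_v)` with `N • Q_i` fixed by `U`:
the cup-product cochain of the two subgroup Kummer cocycles under the local Weil pairing is the coboundary of a continuous
`μ_N(ℚ̄)|`-valued `1`-cochain on `U`. [cite: PoonenRains2012, Prop. 4.8, Cor. 4.6] [cite: BDKim2007, Prop. 3.15] -/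
theorem exists_coboundary_weilLocalPairing_subgroupKummerCocycle (W : WeierstrassCurve ℚ) [W.IsElliptic] (N : ℕ) [NeZero N]
    (e : geomTorsion W N → geomTorsion W N → AlgebraicClosure ℚ) (hμ : ∀ S T, e S T ^ N = 1)
    (hadd₁ : ∀ S₁ S₂ T, e (S₁ + S₂) T = e S₁ T * e S₂ T) (hadd₂ : ∀ S T₁ T₂, e S (T₁ + T₂) = e S T₁ * e S T₂)
    (hgal : ∀ (σ : absoluteGaloisGroup ℚ) (S T : geomTorsion W N), σ • e S T = e (σ • S) (σ • T)) (halt : ∀ T, e T T = 1)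
    (v : HeightOneSpectrum (𝓞 ℚ)) (hn : ((N : ℕ) : ℤ) ≠ 0)
    (U : Subgroup (absoluteGaloisGroup (v.adicCompletion ℚ))) (hU : IsClosed (U : Set (absoluteGaloisGroup (v.adicCompletion ℚ))))
    (Q₁ Q₂ : localPoints W (v.adicCompletion ℚ))
    (hQ₁ : ((N : ℕ) : ℤ) • Q₁ ∈ FixedPoints.addSubgroup U (localPoints W (v.adicCompletion ℚ)))
    (hQ₂ : ((N : ℕ) : ℤ) • Q₂ ∈ FixedPoints.addSubgroup U (localPoints W (v.adicCompletion ℚ))) :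
    ∃ β : C(U, muLocalRep N v), ∀ a b : U,
      (weilLocalPairing W N e hμ hadd₁ hadd₂ hgal v).toLin ((W.subgroupKummerCocycle ((N : ℕ) : ℤ) U hn Q₁ hQ₁).1 a)
          ((torsionLocalRep W N v).ρ (a : absoluteGaloisGroup (v.adicCompletion ℚ))
            ((W.subgroupKummerCocycle ((N : ℕ) : ℤ) U hn Q₂ hQ₂).1 b)) =
        (muLocalRep N v).ρ (a : absoluteGaloisGroup (v.adicCompletion ℚ)) (β b) - β (a * b) + β a := by
  -- notation: the local field, the local curve, the embedding, the torsion comparison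
  -- `CharZero ℚ_v` is kept OUT of the instance cache (it would switch `Algebra ℚ ℚ_v` to `DivisionRing.toRatAlgebra`)
  haveI : IsGalois (v.adicCompletion ℚ) (AlgebraicClosure (v.adicCompletion ℚ)) := by
    haveI : CharZero (v.adicCompletion ℚ) := charZero_of_injective_algebraMap (algebraMap ℚ (v.adicCompletion ℚ)).injective
    exact {}
  have hNF : (N : v.adicCompletion ℚ) ≠ 0 := by
    haveI : CharZero (v.adicCompletion ℚ) := charZero_of_injective_algebraMap (algebraMap ℚ (v.adicCompletion ℚ)).injective
    exact Nat.cast_ne_zero.2 (NeZero.ne N)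
  let ι : AlgebraicClosure ℚ →ₐ[ℚ] AlgebraicClosure (v.adicCompletion ℚ) := closureEmb (K := ℚ) (v.adicCompletion ℚ)
  let θ : geomTorsion W ((N : ℕ) : ℤ) ≃+ AddSubgroup.torsionBy (localPoints W (v.adicCompletion ℚ)) ((N : ℕ) : ℤ) :=
    W.torsionPointsEquiv ((N : ℕ) : ℤ) (E := v.adicCompletion ℚ) hn
  -- torsion of the local curve → torsion of `W` over `ℚ̄`
  let toLoc : geomTorsion (W.baseChange (v.adicCompletion ℚ)) N → AddSubgroup.torsionBy (localPoints W (v.adicCompletion ℚ)) ((N : ℕ) : ℤ) := fun S' ↦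
    ⟨W.geomPointsToLocalPoints (E := v.adicCompletion ℚ) (S' : geomPoints (W.baseChange (v.adicCompletion ℚ))), by
      have h := S'.2
      change ((N : ℕ) : ℤ) • (S' : geomPoints (W.baseChange (v.adicCompletion ℚ))) = 0 at h
      change ((N : ℕ) : ℤ) • W.geomPointsToLocalPoints (E := v.adicCompletion ℚ) (S' : geomPoints (W.baseChange (v.adicCompletion ℚ))) = 0
      rw [← map_zsmul, h, map_zero]⟩
  have toLoc_coe : ∀ S', ((toLoc S' : AddSubgroup.torsionBy (localPoints W (v.adicCompletion ℚ)) ((N : ℕ) : ℤ)) : localPoints W (v.adicCompletion ℚ)) =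
      W.geomPointsToLocalPoints (E := v.adicCompletion ℚ) (S' : geomPoints (W.baseChange (v.adicCompletion ℚ))) := fun _ ↦ rfl
  have toLoc_add : ∀ S₁ S₂, toLoc (S₁ + S₂) = toLoc S₁ + toLoc S₂ := fun S₁ S₂ ↦
    Subtype.ext (by simp only [toLoc_coe, AddSubgroup.coe_add, map_add])
  have toLoc_smul : ∀ (σ : absoluteGaloisGroup (v.adicCompletion ℚ)) S', toLoc (σ • S') = σ • toLoc S' := fun σ S' ↦
    Subtype.ext (by
      rw [toLoc_coe]
      change W.geomPointsToLocalPoints (E := v.adicCompletion ℚ) (σ • (S' : geomPoints (W.baseChange (v.adicCompletion ℚ)))) = σ • (toLoc S' : localPoints W (v.adicCompletion ℚ))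
      rw [W.geomPointsToLocalPoints_smul, toLoc_coe])
  let toK : geomTorsion (W.baseChange (v.adicCompletion ℚ)) N → geomTorsion W ((N : ℕ) : ℤ) := fun S' ↦ θ.symm (toLoc S')
  have toK_add : ∀ S₁ S₂, toK (S₁ + S₂) = toK S₁ + toK S₂ := fun S₁ S₂ ↦ by
    simp only [toK, toLoc_add, map_add]
  have toK_smul : ∀ (σ : absoluteGaloisGroup (v.adicCompletion ℚ)) S', toK (σ • S') = resGal (K := ℚ) (v.adicCompletion ℚ) σ • toK S' := fun σ S' ↦ by
    simp only [toK, toLoc_smul]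
    exact W.torsionPointsEquiv_symm_smul ((N : ℕ) : ℤ) hn σ (toLoc S')
  -- the transported Weil datum on the local curve
  let e' : geomTorsion (W.baseChange (v.adicCompletion ℚ)) N → geomTorsion (W.baseChange (v.adicCompletion ℚ)) N → AlgebraicClosure (v.adicCompletion ℚ) := fun S' T' ↦ ι (e (toK S') (toK T'))
  have hμ' : ∀ S T, e' S T ^ N = 1 := fun S T ↦ by simp only [e', ← map_pow, hμ, map_one]
  have hadd₁' : ∀ S₁ S₂ T, e' (S₁ + S₂) T = e' S₁ T * e' S₂ T := fun S₁ S₂ T ↦ by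
    simp only [e', toK_add, hadd₁, map_mul]
  have hadd₂' : ∀ S T₁ T₂, e' S (T₁ + T₂) = e' S T₁ * e' S T₂ := fun S T₁ T₂ ↦ by
    simp only [e', toK_add, hadd₂, map_mul]
  have halt' : ∀ T, e' T T = 1 := fun T ↦ by simp only [e', halt, map_one]
  -- the points as geometric points of the local curve, and their `U`-invariance hypotheses
  let Q₁' : geomPoints (W.baseChange (v.adicCompletion ℚ)) := W.localPointsToGeomPoints (E := v.adicCompletion ℚ) Q₁
  let Q₂' : geomPoints (W.baseChange (v.adicCompletion ℚ)) := W.localPointsToGeomPoints (E := v.adicCompletion ℚ) Q₂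
  have hfix : ∀ {Q : localPoints W (v.adicCompletion ℚ)}, ((N : ℕ) : ℤ) • Q ∈ FixedPoints.addSubgroup U (localPoints W (v.adicCompletion ℚ)) →
      ∀ σ : U, (σ : absoluteGaloisGroup (v.adicCompletion ℚ)) • ((N : ℤ) • W.localPointsToGeomPoints (E := v.adicCompletion ℚ) Q) =
        (N : ℤ) • W.localPointsToGeomPoints (E := v.adicCompletion ℚ) Q := by
    intro Q hQ σ
    have h : (σ : absoluteGaloisGroup (v.adicCompletion ℚ)) • (((N : ℕ) : ℤ) • Q) = ((N : ℕ) : ℤ) • Q := (FixedPoints.mem_addSubgroup _ _ _).1 hQ σ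
    rw [← map_zsmul, ← W.localPointsToGeomPoints_smul, h]
  -- ISO-1a on the local curve
  obtain ⟨β', hβ'⟩ := exists_muCarrier_coboundary_subgroup (W := W.baseChange (v.adicCompletion ℚ)) hNF e' hμ' hadd₁' hadd₂' halt' U hU Q₁' Q₂'
    (hfix hQ₁) (hfix hQ₂)
  -- pull the cochain back to `μ_N(ℚ̄)` along `muTransfer` (onto: the roots of unity of `ℚ̄_v` come from `ℚ̄`)
  have hsurj : ∀ y : MuCarrier (v.adicCompletion ℚ) N, ∃ x : MuCarrier ℚ N, muTransfer ℚ (v.adicCompletion ℚ) N x = y := by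
    intro y
    haveI : CharZero (v.adicCompletion ℚ) := charZero_of_injective_algebraMap (algebraMap ℚ (v.adicCompletion ℚ)).injective
    obtain ⟨x, hx⟩ := (muTransfer_bijective ℚ (v.adicCompletion ℚ) N).2 y
    refine ⟨x, ?_⟩
    convert hx using 4
    all_goals exact Subsingleton.elim _ _
  have hval : ∀ x : MuCarrier ℚ N, muFieldVal (muTransfer ℚ (v.adicCompletion ℚ) N x) = ι (muFieldVal x) := fun x ↦ by
    change ((muVal (v.adicCompletion ℚ) N (muTransfer ℚ (v.adicCompletion ℚ) N x) : (AlgebraicClosure (v.adicCompletion ℚ))ˣ) :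
        AlgebraicClosure (v.adicCompletion ℚ)) = ι ((muVal ℚ N x : (AlgebraicClosure ℚ)ˣ) : _)
    rw [muVal_muTransfer, Units.coe_map, MonoidHom.coe_coe, ← closureEmb_eq_absClosureEmbedding]
    rfl
  have hinj : Function.Injective (muTransfer ℚ (v.adicCompletion ℚ) N) := fun x y h ↦ by
    have h' := congrArg muFieldVal h
    rw [hval, hval] at h'
    exact muFieldVal_injective (ι.injective h')
  let g : MuCarrier (v.adicCompletion ℚ) N → MuCarrier ℚ N := fun y ↦ (hsurj y).choose
  have hg : ∀ y, muTransfer ℚ (v.adicCompletion ℚ) N (g y) = y := fun y ↦ (hsurj y).choose_spec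
  let β : C(U, muLocalRep N v) := ⟨fun a ↦ g (β' a), (continuous_of_discreteTopology (f := g)).comp β'.continuous⟩
  have hβtr : ∀ a, muTransfer ℚ (v.adicCompletion ℚ) N (β a) = β' a := fun a ↦ hg (β' a)
  refine ⟨β, fun a b ↦ ?_⟩
  -- compare after the injective `μ_N(ℚ̄) → μ_N(ℚ̄_v) → ℚ̄_v`
  apply hinj
  apply muFieldVal_injective
  -- the inverse torsion comparison `E[N](ℚ̄) → E_{ℚ_v}[N](ℚ̄_v)`
  let fromK : geomTorsion W ((N : ℕ) : ℤ) → geomTorsion (W.baseChange (v.adicCompletion ℚ)) N := fun R ↦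
    ⟨W.localPointsToGeomPoints (E := v.adicCompletion ℚ) (pointsMap W (v.adicCompletion ℚ) (R : geomPoints W)), by
      change ((N : ℕ) : ℤ) • W.localPointsToGeomPoints (E := v.adicCompletion ℚ)
        (pointsMap W (v.adicCompletion ℚ) (R : geomPoints W)) = 0
      rw [← map_zsmul, ← map_zsmul, (Submodule.mem_torsionBy_iff _ _).1 R.2]
      simp only [map_zero]⟩
  have fromK_coe : ∀ R, ((fromK R : geomTorsion (W.baseChange (v.adicCompletion ℚ)) N) :
      geomPoints (W.baseChange (v.adicCompletion ℚ))) =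
      W.localPointsToGeomPoints (E := v.adicCompletion ℚ) (pointsMap W (v.adicCompletion ℚ) (R : geomPoints W)) := fun _ ↦ rfl
  have htoK : ∀ R, toK (fromK R) = R := fun R ↦ by
    change θ.symm (toLoc (fromK R)) = R
    rw [AddEquiv.symm_apply_eq]
    exact Subtype.ext (by rw [toLoc_coe, fromK_coe, W.coe_torsionPointsEquiv_apply]; rfl)
  -- the two arguments of the pairing
  set S := (W.subgroupKummerCocycle ((N : ℕ) : ℤ) U hn Q₁ hQ₁).1 a with hSdef
  set T := (torsionLocalRep W N v).ρ (a : absoluteGaloisGroup (v.adicCompletion ℚ))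
    ((W.subgroupKummerCocycle ((N : ℕ) : ℤ) U hn Q₂ hQ₂).1 b) with hTdef
  have hS' : ((fromK S : geomTorsion (W.baseChange (v.adicCompletion ℚ)) N) : geomPoints (W.baseChange (v.adicCompletion ℚ))) =
      (a : absoluteGaloisGroup (v.adicCompletion ℚ)) • Q₁' - Q₁' := by
    rw [fromK_coe, hSdef, W.pointsMap_subgroupKummerCocycle_apply, map_sub, W.localPointsToGeomPoints_smul]
  have hTcoe : ((T : geomTorsion W ((N : ℕ) : ℤ)) : geomPoints W) =
      resGal (K := ℚ) (v.adicCompletion ℚ) (a : absoluteGaloisGroup (v.adicCompletion ℚ)) •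
        (((W.subgroupKummerCocycle ((N : ℕ) : ℤ) U hn Q₂ hQ₂).1 b : geomTorsion W ((N : ℕ) : ℤ)) : geomPoints W) := by
    rw [hTdef, resGal_eq_absGaloisRestrict]; rfl
  have hT' : ((fromK T : geomTorsion (W.baseChange (v.adicCompletion ℚ)) N) : geomPoints (W.baseChange (v.adicCompletion ℚ))) =
      (a : absoluteGaloisGroup (v.adicCompletion ℚ)) • ((b : absoluteGaloisGroup (v.adicCompletion ℚ)) • Q₂' - Q₂') := by
    rw [fromK_coe, hTcoe, pointsMap_smul, W.pointsMap_subgroupKummerCocycle_apply, W.localPointsToGeomPoints_smul, map_sub,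
      W.localPointsToGeomPoints_smul]
  have key := hβ' a b (fromK S) (fromK T) hS' hT'
  -- left-hand side: `ι (e S T) = e' (fromK S) (fromK T)`
  have hLHS : muFieldVal (muTransfer ℚ (v.adicCompletion ℚ) N ((weilLocalPairing W N e hμ hadd₁ hadd₂ hgal v).toLin S T)) =
      e' (fromK S) (fromK T) := by
    rw [hval]
    change ι (muFieldVal (weilPairingHom W N e hμ hadd₁ hadd₂ S T)) = ι (e (toK (fromK S)) (toK (fromK T)))
    rw [htoK, htoK]
    rfl
  have hρ : muTransfer ℚ (v.adicCompletion ℚ) N ((muLocalRep N v).ρ (a : absoluteGaloisGroup (v.adicCompletion ℚ)) (β b)) =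
      (mu (v.adicCompletion ℚ) N).toTopRep.ρ (a : absoluteGaloisGroup (v.adicCompletion ℚ)) (β' b) := by
    change muTransfer ℚ (v.adicCompletion ℚ) N (mu ℚ N (absGaloisRestrict ℚ (v.adicCompletion ℚ)
      (a : absoluteGaloisGroup (v.adicCompletion ℚ))) (β b)) = mu (v.adicCompletion ℚ) N (a : absoluteGaloisGroup (v.adicCompletion ℚ)) (β' b)
    rw [muTransfer_mu, hβtr]
  rw [hLHS, key, map_add, map_sub, hβtr, hβtr, hρ]

end Summit.BirchSwinnertonDyer.BirchSwinnertonDyer.Theorems.SignedEC.LayerKummerIso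

end
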